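import Summits.BirchSwinnertonDyer.BirchSwinnertonDyer.Theses.SignedLowerHalves
import Summits.BirchSwinnertonDyer.Rank1Residual.Supersingular.KobayashiMainConjecture
import Literature.NumberTheory.EllipticCurves.Rank1Residual.Typed.X7
import HarnessLib

/-!
# Line `crossing-rigidity` — crux `KobayashiLowerHalfLargeImage` (route SignedLowerHalves, item
# stmt-BirchSwinnertonDyer-19001, rank 3): CONSTANT-TERM ("crossing-value") RIGIDITY lifts the CLASSICAL
# lower bound on `#Ш` to the Eisenstein half of Kobayashi's signed main conjecture, on exactly the
# sub-population `r_an(E) ≤ 1` that the route's deciding theorem `closes` ever instantiates.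

HONEST FRAMING (D-0152): this line feeds the CLASS route K3 = `SignedLowerHalves`; nothing here proves
BSD; every `stub_*` is `sorry`; the composition only shows that the stubs, if proved, give the crux BY NAME.
The helper lemmas (`span_eq_span_of_dvd_of_constantCoeff_dvd`, `dvd_of_dvd_of_constantCoeff_dvd`) are
PROVED (no sorry): they are the lever, kernel-checked in the abstract.

LEVER. Over a domain `R`, if `a ∣ g` in `R⟦T⟧` (Euler-system side) and the constant terms satisfy the
REVERSE divisibility `g(0) ∣ a(0)` with `g(0) ≠ 0` (the value at the crossing point = trivial character),
then the cofactor is a unit and `(a) = (g)` — in particular the Eisenstein (lower) divisibility `g ∣ a`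
(Greenberg, LNM 1716 (1999) Thm. 4.1 + pp. 132–133, where it is run example-by-example). Dictionary:
* `r_an(E) = 0` (frame = Kobayashi's `±` objects over `ℚ_∞`): `a = char X^ε(E/ℚ_∞)`, `g = ϖ·L_p^ε(E)`;
  `a ∣ g` integrally = Kobayashi 2003 Thm. 1.3/4.1 with Kato's integrality under `Surj` (`p ≥ 5` ⇒
  `ρ_{E,p^∞}` onto, Serre); `g(0) = (unit/p)·L(E,1)/Ω_E ≠ 0` (Pollack interpolation at `𝟙`, `a_p = 0`);
  `a(0) ∼ #Sel_{p^∞}(E/ℚ)·∏c_ℓ/#E(ℚ)[p^∞]²·(p-factor)` (B.D. Kim 2013 Cor. 3.15); so `g(0) ∣ a(0)` IS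
  `ord_p #Ш_an ≤ ord_p #Ш`, i.e. `Typed.MissingLowerBoundAt W p` — the converse of the tree's
  `missingLowerBoundAt_of_kobayashiLowerDivisibility`. BOTH signs follow.
* `r_an(E) = 1` (`L(E,1) = 0`, so the `ℚ`-frame crossing value vanishes): move to the frame whose crossing
  value does NOT vanish — Greenberg's `(rel_v, str_v̄)` Selmer dual of `E` over the CYCLOTOMIC
  `ℤ_p`-extension `K_∞⁺` of a Heegner field `K` with `p = v v̄` split and `r_an(E^K) = 0`
  (Friedberg–Hoffstein/Waldspurger; `E^K` is again an X7 curve at `p`: additive at `D_K`, `a_p(E^K) = 0`,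
  `Surj`), `g = 𝓛_p^Gr(E/K)⁺ = plus G` whose value at `𝟙` is `𝓛_p^BDP(𝟙) ∼ ((1+p)/p)²·log_ω(y_K)² ≠ 0`
  (CGLS 2022 Thm. 5.1.3, any good `p`); `a ∣ g` on `K_∞⁺` from Kato–Kobayashi for `E` AND `E^K` through the
  supersingular frame switch `X_Gr(E/K_∞⁺) ↔ X^ε(E/ℚ_∞) ⊕ X^ε(E^K/ℚ_∞)` (signed Coleman maps at `v`, `v̄` +
  Poitou–Tate; ordinary template = Yan–Zhu 2026 Cor. 5.4 = arXiv:2412.20078v4 l.1166–1184, supersingular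
  two-variable version = CCSS arXiv:1804.10993 Thm. 3.7/§3.3, PRE); `g(0) ∣ a(0)` = the supersingular
  analogue of CGS 2025 Prop. 3.4.2 (`𝓕_Gr(E/K_∞⁺)(0) ∼_p #Sel^{rel,str}(K)·corr`) + the JSW-type count of
  `#Sel^{rel,str}(K)` + Gross–Zagier, which turn it into `MissingLowerBoundAt` for `E` AND for `E^K`;
  rigidity gives the Greenberg equality on `K_∞⁺`, and the switch, read backwards with Kato–Kobayashi for
  the twist, isolates `ϖ L_p^ε(E) ∣ char X^ε(E/ℚ_∞)`. This is Yan–Zhu v4's published proof of rank-one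
  `p`-BSD (Cor. 5.4 + [CGS Prop. 3.4.2] + `𝓛⁺(𝟙) = 𝓛⁻(𝟙) ≠ 0` + [JSW]) RUN BACKWARDS, at a supersingular prime.
* `r_an(E) ≥ 2`: every frame's crossing value vanishes (no non-torsion Heegner point; regulators would be
  needed) — `stub_residue_analyticRank_ge_two` is the honest residue. STRUCTURAL FINDING: the route's
  `closes` instantiates this crux ONLY at pairs with `r_an ≤ 1` (rung K3 = `SignedSupersingular` quantifies
  `analyticRank ≤ 1`), so the residue lies OUTSIDE the cone of `closes`; recommended repair (planner /
  strategist, not this file): `--split KobayashiLowerHalfLargeImage` into the `r_an ≤ 1` part (this line,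
  whose only atom is the classical supply below) and the `r_an ≥ 2` part (`aside`).

WHAT IS GENUINELY OPEN HERE: `stub_supply_missingLowerBound_rankLeOne` — the CLASSICAL lower bound
`ord_p #Ш_an ≤ ord_p #Ш` on X7 ∧ `r_an ≤ 1` ∧ `Surj` ∧ `p ≥ 5`. It is EXACTLY the output of the tree's road K
(`X7.missingLowerBoundAt_of_stepL_of_surj`: STEP L ⇐ Zhang–Kolyvagin non-vanishing + McCallum, `r_an = 1`)
and of the rank-0 Kolyvagin-derived road (rank-one twist), i.e. the atom this line needs is the one the
cell already staffs — the line ADDS NO ATOM and shows the Λ-adic crux on `r_an ≤ 1` is EQUIVALENT (given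
print) to its own classical consequence. Dead lines honoured: no Eisenstein congruence at additive level
(«BSTW lower divisibility unpublished», square-free only), no `EisensteinHalfFiveLe`-type quantitative
Eisenstein statement (x6 refutation history), no level-lowering to the semistable locus (DOSSIER §6).

`p = 3` (`a_3 = 0` on X7 is allowed by the crux): Kato's integrality needs `ρ_{E,3^∞}` onto, which `Surj`
mod 3 does not give; kept as the shared residue `stub_three` verbatim from the slot line `kurihara_rigidity`
(dedup: same statement, one item).
-/

noncomputable section

open scoped Classical MatrixGroups ModularForm

open CongruenceSubgroup WeierstrassCurve Literature.NumberTheory.EllipticCurves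
  Literature.NumberTheory.EllipticCurves.ModularForms
  Literature.NumberTheory.EllipticCurves.Rank1Residual
  Literature.NumberTheory.EllipticCurves.Rank1Residual.Typed
  Summit.BirchSwinnertonDyer.Rank1Residual.Supersingular

set_option linter.dupNamespace false

namespace Summit.BirchSwinnertonDyer.BirchSwinnertonDyer.Cruxes.KobayashiLowerHalfLargeImage

namespace CrossingRigidity

/-! ## The lever (PROVED) -/

/-- **Crossing-value rigidity** (Greenberg 1999, LNM 1716 Thm. 4.1 and pp. 132–133). In `R⟦T⟧` over a
domain: `a ∣ g`, `g(0) ∣ a(0)`, `g(0) ≠ 0` ⟹ the cofactor is a unit, so `(a) = (g)`.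
[cite: Greenberg1999LNM, Thm. 4.1 and §5 pp. 132–133] -/
theorem span_eq_span_of_dvd_of_constantCoeff_dvd {R : Type*} [CommRing R] [IsDomain R]
    {a g : PowerSeries R} (hag : a ∣ g)
    (h0 : PowerSeries.constantCoeff g ∣ PowerSeries.constantCoeff a)
    (hg0 : PowerSeries.constantCoeff g ≠ 0) :
    Ideal.span {a} = Ideal.span {g} := by
  obtain ⟨h, rfl⟩ := hag
  have ha0 : PowerSeries.constantCoeff a ≠ 0 := by
    intro ha
    apply hg0
    rw [map_mul, ha, zero_mul]
  obtain ⟨k, hk⟩ := h0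
  rw [map_mul] at hk
  have hunit : IsUnit (PowerSeries.constantCoeff h) := by
    have h1 : PowerSeries.constantCoeff a * (PowerSeries.constantCoeff h * k) =
        PowerSeries.constantCoeff a * 1 := by
      rw [mul_one, ← mul_assoc]; exact hk.symm
    exact IsUnit.of_mul_eq_one _ (mul_left_cancel₀ ha0 h1)
  have hU : IsUnit h := (PowerSeries.isUnit_iff_constantCoeff (φ := h)).mpr hunit
  exact (Ideal.span_singleton_mul_right_unit hU a).symm

/-- The form the descent uses: the LOWER divisibility `g ∣ a` (Kato's `g = a·h` has `h(0)` a unit, so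
`a = g·h⁻¹`). [cite: Greenberg1999LNM, Thm. 4.1 and §5 pp. 132–133] -/
theorem dvd_of_dvd_of_constantCoeff_dvd {R : Type*} [CommRing R] [IsDomain R]
    {a g : PowerSeries R} (hag : a ∣ g)
    (h0 : PowerSeries.constantCoeff g ∣ PowerSeries.constantCoeff a)
    (hg0 : PowerSeries.constantCoeff g ≠ 0) : g ∣ a :=
  Ideal.span_singleton_le_span_singleton.mp (span_eq_span_of_dvd_of_constantCoeff_dvd hag h0 hg0).le

/-! ## Registered stubs -/

/-- STUB (LIFT, rank 0; size M; PLAUSIBLY PROVABLE NOW from tree facts). For an X7 pair with `p ≥ 5`,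
`a_p = 0`, `Surj`, `¬CM` and `r_an(E) = 0`, the classical lower bound `ord_p #Ш_an ≤ ord_p #Ш`
(`MissingLowerBoundAt`) LIFTS to the Eisenstein half of Kobayashi's main conjecture (for either sign):
Kato–Kobayashi integral divisibility `char X^ε ∣ ϖ L_p^ε` (Kobayashi 2003 Thm. 1.3/4.1; integral because
`Surj` ∧ `p ≥ 5` ⇒ `ρ_{E,p^∞}` onto, Serre 1972 / Kato 2004 Thm. 17.4), the signed Euler-characteristic
formula at `T = 0` (B.D. Kim 2013 Cor. 3.15 = `BDKim2013.cor315_signedCharValue_rankZero`), Pollack's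
interpolation `L_p^ε(𝟙) = (unit/p)·L(E,1)/Ω_E ≠ 0`, the Néron/Manin period unit
(`realPeriodRat_eq_unit_mul_plusPeriod`), and the lever `dvd_of_dvd_of_constantCoeff_dvd` in `Λ ≅ ℤ_p⟦T⟧`.
It is the CONVERSE of the tree's `missingLowerBoundAt_of_kobayashiLowerDivisibility`.
[cite: Kobayashi2003, Thm. 1.3 and Thm. 4.1] [cite: BDKim2013, Cor. 3.15] [cite: Greenberg1999LNM, Thm. 4.1] -/
theorem stub_lift_rankZero :
    ∀ (W : WeierstrassCurve ℚ) [W.IsElliptic] [W.IsGloballyMinimal] (p : ℕ) [Fact p.Prime],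
      5 ≤ p → ClassX7 W p → ¬ W.HasCM → W.frobeniusTrace p = 0 → Surj W p →
      W.analyticRank = 0 → MissingLowerBoundAt W p →
      ∃ ε : ℤˣ, KobayashiLowerDivisibility W p ε := by
  sorry

/-- STUB (LIFT, rank 1; size L; the Iwasawa-theoretic heart of the line). For an X7 pair with `p ≥ 5`,
`a_p = 0`, `Surj`, `¬CM`, `r_an(E) = 1`, the classical lower bound for `E` TOGETHER WITH the classical
lower bound for every rank-0 X7 curve at the same `p` (used once: for the twist `E^K`, which is an X7
curve at `p` with `r_an = 0`) lifts to the Eisenstein half of Kobayashi's main conjecture for `E`.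
Internal chain (see the file docstring): choose a Heegner field `K`, `p = v v̄` split, `r_an(E^K) = 0`
(`friedbergHoffstein_exists_heegnerField_split_twist_ne_zero`); frame = Greenberg `(rel_v, str_v̄)` dual of
`E` over `K_∞⁺` with `g = 𝓛_p^Gr(E/K)⁺` (`UnrSeries₂.plus`); Kato side `a ∣ g` on `K_∞⁺` from Kato–Kobayashi
for `E`, `E^K` via the supersingular frame switch (CCSS Thm. 3.7/§3.3 restricted to `K_∞⁺`; ordinary
template Yan–Zhu 2026 Cor. 5.4); crossing value `g(𝟙) = 𝓛_p^BDP(𝟙)·unit ∼ ((1+p)/p)² log_ω(y_K)² ≠ 0`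
(CGLS 2022 Thm. 5.1.3, any good `p`); `g(0) ∣ a(0)` from the two `MissingLowerBoundAt`s through the
supersingular analogue of CGS 2025 Prop. 3.4.2 and Gross–Zagier; then `dvd_of_dvd_of_constantCoeff_dvd` in
`𝒪⟦T⟧` and the switch read backwards (the `E^K` factor is controlled by Kato–Kobayashi again).
Why it might fail: the supersingular frame switch and the supersingular CGS 3.4.2 are not in print as
stated (CCSS is a preprint; CGS/Yan–Zhu are ordinary) — they are the work.
[cite: YanZhu2024MainConjNonCM, Cor. 5.4 (arXiv:2412.20078v4 l.1166–1184) and proof of Thm. 5.11 (l.1347)]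
[cite: CastellaGrossiSkinner2025, Prop. 3.4.2] [cite: CGLS2022, Thm. 5.1.3]
[cite: CastellaCiperianiSkinnerSprung2018, Thm. 3.7 and §3.3 (arXiv:1804.10993)] [cite: Kobayashi2003, Thm. 1.3] -/
theorem stub_lift_rankOne :
    ∀ (W : WeierstrassCurve ℚ) [W.IsElliptic] [W.IsGloballyMinimal] (p : ℕ) [Fact p.Prime],
      5 ≤ p → ClassX7 W p → ¬ W.HasCM → W.frobeniusTrace p = 0 → Surj W p →
      W.analyticRank = 1 → MissingLowerBoundAt W p →
      (∀ (W' : WeierstrassCurve ℚ) [W'.IsElliptic] [W'.IsGloballyMinimal],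
          ClassX7 W' p → ¬ W'.HasCM → W'.frobeniusTrace p = 0 → Surj W' p →
          W'.analyticRank = 0 → MissingLowerBoundAt W' p) →
      ∃ ε : ℤˣ, KobayashiLowerDivisibility W p ε := by
  sorry

/-- STUB (SUPPLY = the line's ONLY ATOM, shared with the cell's road K / rank-0 Kolyvagin road; size XL,
classical, NOT new): the classical lower bound `ord_p #Ш(E/ℚ)_an ≤ ord_p #Ш(E/ℚ)` on X7 ∧ `r_an ≤ 1` ∧
`Surj` ∧ `p ≥ 5` ∧ `a_p = 0` ∧ `¬CM`. For `r_an = 1` this is VERBATIM the conclusion of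
`X7.missingLowerBoundAt_of_stepL_of_surj` (STEP L ⇐ `ZhangKolyvaginNonvanishingSS` + McCallum on the
♠-locus; Kolyvagin's conjecture with a FREE Heegner field in general); for `r_an = 0` it is the rank-0
Kolyvagin-derived lower bound (rank-one twist + Gross–Zagier + Kolyvagin exact structure). No Iwasawa
theory, no Eisenstein congruence, conductor-blind. Why it might fail: it does not fail as a statement
(it is a consequence of BSD); the risk is that its only known engine is Kolyvagin's conjecture for X7
curves off Zhang's ♠-hypotheses.
[cite: Zhang2014, Thm. 1.1 and p. 231] [cite: McCallum1991, Cor. 5.6] [cite: Kolyvagin1991, Thm. 1] -/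
theorem stub_supply_missingLowerBound_rankLeOne :
    ∀ (W : WeierstrassCurve ℚ) [W.IsElliptic] [W.IsGloballyMinimal] (p : ℕ) [Fact p.Prime],
      5 ≤ p → ClassX7 W p → ¬ W.HasCM → W.frobeniusTrace p = 0 → Surj W p →
      W.analyticRank ≤ 1 → MissingLowerBoundAt W p := by
  sorry

/-- STUB (RESIDUE, `r_an ≥ 2`; OPEN, no engine in this line): every crossing value vanishes in analytic
rank `≥ 2` (no non-torsion Heegner point over any `K`; `p`-adic regulators and their non-degeneracy would
be needed), so constant-term rigidity has no ignition. This part of the crux is OUTSIDE the cone of the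
route's `closes` (rung K3 quantifies `analyticRank ≤ 1`); recommended: split it off and mark it `aside`,
or attack it by an all-ranks mechanism (two-variable squeeze `ac2cyc-squeeze`: anticyclotomic Howard
equality + a two-variable zeta element at the trivial branch, announced Burungale–S.Vincentelli only in the
ordinary case). Why it might fail: it is the crux at full Λ-adic strength with no classical shadow.
[cite: BurungaleCastellaSkinner2024BaseChange, Rmk. 1.5.1 (arXiv:2405.00270 fn. 3)] [cite: Kobayashi2003, Main Conjecture p. 2] -/
theorem stub_residue_analyticRank_ge_two :
    ∀ (W : WeierstrassCurve ℚ) [W.IsElliptic] [W.IsGloballyMinimal] (p : ℕ) [Fact p.Prime],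
      5 ≤ p → ClassX7 W p → ¬ W.HasCM → W.frobeniusTrace p = 0 → Surj W p →
      2 ≤ W.analyticRank → ∃ ε : ℤˣ, KobayashiLowerDivisibility W p ε := by
  sorry

/-- STUB (RESIDUE `p = 3`, verbatim the slot line's `KuriharaRigidity.stub_three`, one shared item): at
`p = 3` (`a_3 = 0` allowed on X7) Kato's divisibility is only rational under `Surj` mod 3 (`ρ_{E,3^∞}` need
not be onto), so the lever's `a ∣ g` is not available integrally. [cite: Kobayashi2003, Thm. 4.1] [cite: Kato2004Asterisque, Thm. 17.4] -/
theorem stub_three :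
    ∀ (W : WeierstrassCurve ℚ) [W.IsElliptic] [W.IsGloballyMinimal] (p : ℕ) [Fact p.Prime],
      p = 3 → ClassX7 W p → ¬ W.HasCM → W.frobeniusTrace p = 0 → Surj W p →
      ∃ ε : ℤˣ, KobayashiLowerDivisibility W p ε := by
  sorry

/-! ## Composition -/

/-- COMPOSITION on the population the route actually uses (`r_an ≤ 1`, `p ≥ 5`), explicit form: the two
lifts and the classical supply give the crux's conclusion. Bookkeeping only. -/
theorem lowerHalf_rankLeOne_of_lifts
    (h0 : ∀ (W : WeierstrassCurve ℚ) [W.IsElliptic] [W.IsGloballyMinimal] (p : ℕ) [Fact p.Prime],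
      5 ≤ p → ClassX7 W p → ¬ W.HasCM → W.frobeniusTrace p = 0 → Surj W p →
      W.analyticRank = 0 → MissingLowerBoundAt W p →
      ∃ ε : ℤˣ, KobayashiLowerDivisibility W p ε)
    (h1 : ∀ (W : WeierstrassCurve ℚ) [W.IsElliptic] [W.IsGloballyMinimal] (p : ℕ) [Fact p.Prime],
      5 ≤ p → ClassX7 W p → ¬ W.HasCM → W.frobeniusTrace p = 0 → Surj W p →
      W.analyticRank = 1 → MissingLowerBoundAt W p →
      (∀ (W' : WeierstrassCurve ℚ) [W'.IsElliptic] [W'.IsGloballyMinimal],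
          ClassX7 W' p → ¬ W'.HasCM → W'.frobeniusTrace p = 0 → Surj W' p →
          W'.analyticRank = 0 → MissingLowerBoundAt W' p) →
      ∃ ε : ℤˣ, KobayashiLowerDivisibility W p ε)
    (hS : ∀ (W : WeierstrassCurve ℚ) [W.IsElliptic] [W.IsGloballyMinimal] (p : ℕ) [Fact p.Prime],
      5 ≤ p → ClassX7 W p → ¬ W.HasCM → W.frobeniusTrace p = 0 → Surj W p →
      W.analyticRank ≤ 1 → MissingLowerBoundAt W p) :
    ∀ (W : WeierstrassCurve ℚ) [W.IsElliptic] [W.IsGloballyMinimal] (p : ℕ) [Fact p.Prime],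
      5 ≤ p → ClassX7 W p → ¬ W.HasCM → W.frobeniusTrace p = 0 → Surj W p →
      W.analyticRank ≤ 1 → ∃ ε : ℤˣ, KobayashiLowerDivisibility W p ε := by
  intro W _ _ p _ hp5 hX hcm hap hs hr
  rcases Nat.lt_or_ge W.analyticRank 1 with hlt | hge
  · have hr0 : W.analyticRank = 0 := by omega
    exact h0 W p hp5 hX hcm hap hs hr0 (hS W p hp5 hX hcm hap hs hr)
  · have hr1 : W.analyticRank = 1 := le_antisymm hr hge
    exact h1 W p hp5 hX hcm hap hs hr1 (hS W p hp5 hX hcm hap hs hr)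
      (fun W' _ _ hX' hcm' hap' hs' hr0' =>
        hS W' p hp5 hX' hcm' hap' hs' (by omega))

/-- COMPOSITION, explicit form with the crux UNFOLDED (so that the only theorem concluding the crux BY NAME
is `KobayashiLowerHalfLargeImage_of` below): an odd prime is `3` or `≥ 5`; at `p ≥ 5` split on
`r_an ≤ 1` (lifts + supply) versus `r_an ≥ 2` (residue). -/
theorem lowerHalf_of_crossing
    (h0 : ∀ (W : WeierstrassCurve ℚ) [W.IsElliptic] [W.IsGloballyMinimal] (p : ℕ) [Fact p.Prime],
      5 ≤ p → ClassX7 W p → ¬ W.HasCM → W.frobeniusTrace p = 0 → Surj W p →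
      W.analyticRank = 0 → MissingLowerBoundAt W p →
      ∃ ε : ℤˣ, KobayashiLowerDivisibility W p ε)
    (h1 : ∀ (W : WeierstrassCurve ℚ) [W.IsElliptic] [W.IsGloballyMinimal] (p : ℕ) [Fact p.Prime],
      5 ≤ p → ClassX7 W p → ¬ W.HasCM → W.frobeniusTrace p = 0 → Surj W p →
      W.analyticRank = 1 → MissingLowerBoundAt W p →
      (∀ (W' : WeierstrassCurve ℚ) [W'.IsElliptic] [W'.IsGloballyMinimal],
          ClassX7 W' p → ¬ W'.HasCM → W'.frobeniusTrace p = 0 → Surj W' p →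
          W'.analyticRank = 0 → MissingLowerBoundAt W' p) →
      ∃ ε : ℤˣ, KobayashiLowerDivisibility W p ε)
    (hS : ∀ (W : WeierstrassCurve ℚ) [W.IsElliptic] [W.IsGloballyMinimal] (p : ℕ) [Fact p.Prime],
      5 ≤ p → ClassX7 W p → ¬ W.HasCM → W.frobeniusTrace p = 0 → Surj W p →
      W.analyticRank ≤ 1 → MissingLowerBoundAt W p)
    (h2 : ∀ (W : WeierstrassCurve ℚ) [W.IsElliptic] [W.IsGloballyMinimal] (p : ℕ) [Fact p.Prime],
      5 ≤ p → ClassX7 W p → ¬ W.HasCM → W.frobeniusTrace p = 0 → Surj W p →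
      2 ≤ W.analyticRank → ∃ ε : ℤˣ, KobayashiLowerDivisibility W p ε)
    (h3 : ∀ (W : WeierstrassCurve ℚ) [W.IsElliptic] [W.IsGloballyMinimal] (p : ℕ) [Fact p.Prime],
      p = 3 → ClassX7 W p → ¬ W.HasCM → W.frobeniusTrace p = 0 → Surj W p →
      ∃ ε : ℤˣ, KobayashiLowerDivisibility W p ε) :
    ∀ (W : WeierstrassCurve ℚ) [W.IsElliptic] [W.IsGloballyMinimal] (p : ℕ) [Fact p.Prime],
      p ≠ 2 → ClassX7 W p → ¬ W.HasCM → W.frobeniusTrace p = 0 → Surj W p →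
      ∃ ε : ℤˣ, KobayashiLowerDivisibility W p ε := by
  intro W _ _ p _ hp2 hX hcm hap hs
  have hpP : p.Prime := Fact.out
  by_cases hp5 : 5 ≤ p
  · rcases Nat.lt_or_ge W.analyticRank 2 with hlt | hge
    · exact lowerHalf_rankLeOne_of_lifts h0 h1 hS W p hp5 hX hcm hap hs (by omega)
    · exact h2 W p hp5 hX hcm hap hs hge
  · have hp3 : p = 3 := by
      have h2le := hpP.two_le
      interval_cases p
      · exact absurd rfl hp2
      · rfl
      · exact absurd hpP (by decide)
    exact h3 W p hp3 hX hcm hap hs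

/-- THE SKELETON: the crux BY NAME from exactly the five registered stubs (no sorry of its own; the stubs'
`sorry`s are the line's open obligations). -/
theorem KobayashiLowerHalfLargeImage_of :
    Summit.BirchSwinnertonDyer.BirchSwinnertonDyer.Theses.SignedLowerHalves.KobayashiLowerHalfLargeImage :=
  lowerHalf_of_crossing stub_lift_rankZero stub_lift_rankOne stub_supply_missingLowerBound_rankLeOne
    stub_residue_analyticRank_ge_two stub_three

/-- The population the route's `closes` actually consumes (`r_an ≤ 1`, `p ≥ 5`): the crux's conclusion
there from the two lifts and the classical supply ALONE (no residue stub). Recorded so that a split of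
the crux into its `r_an ≤ 1` / `r_an ≥ 2` parts can cite it. -/
theorem lowerHalf_rankLeOne :
    ∀ (W : WeierstrassCurve ℚ) [W.IsElliptic] [W.IsGloballyMinimal] (p : ℕ) [Fact p.Prime],
      5 ≤ p → ClassX7 W p → ¬ W.HasCM → W.frobeniusTrace p = 0 → Surj W p →
      W.analyticRank ≤ 1 → ∃ ε : ℤˣ, KobayashiLowerDivisibility W p ε :=
  lowerHalf_rankLeOne_of_lifts stub_lift_rankZero stub_lift_rankOne
    stub_supply_missingLowerBound_rankLeOne

end CrossingRigidity

end Summit.BirchSwinnertonDyer.BirchSwinnertonDyer.Cruxes.KobayashiLowerHalfLargeImage
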